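import Summits.AtomisticToContinuum.HydrodynamicLimit.Theorems.OneFlightGossipEngineEnergyCurrentTailsLevelCensusLedgerIdentity
import Summits.AtomisticToContinuum.HydrodynamicLimit.Theorems.OneFlightGossipEngineEnergyCurrentTailsLevelCensusStatics
import Summits.AtomisticToContinuum.HydrodynamicLimit.Theorems.OneFlightGossipEngineEnergyCurrentTailsLevelCensusEventMeasurable
import Literature.MathematicalPhysics.KineticTheory.HardSphereTwoTimePressure
import HarnessLib

/-!
# Stub A of the line `level-census-comparison`: the census ledger and the a-priori inputs
# (crux `EnergyCurrentTails`, stmt-AtomisticToContinuum-9235)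

Assembly file of the registered stub `stub_censusLedger : CensusLedger` (statement and objects in
`…Theorems.OneFlightGossipEngineEnergyCurrentTailsLevelCensusObjects`; primary crux decl
`Summit.AtomisticToContinuum.HydrodynamicLimit.Theses.WarmColdDichotomy.EnergyCurrentTails`, route
copy `…Theses.OneFlightGossipEngine.EnergyCurrentTails`).  `CensusLedger` is the chaos-free input of
the line's closure `stub_censusClosure : CensusLedger → RateCeiling → MergeCeiling → SplitFloor →
GaussianCensusBound`; with `σ₀ = 1/2` its four parts are the three landed helpers:

* (i) the CROSSING LEDGER `n_{s'}(E) + E#down(s,s'] = n_s(E) + E#up(s,s']` in `ℝ≥0∞` —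
  `censusLedger_identity` (`…LevelCensusLedgerIdentity`: weak balance law for the level count,
  `κ_E ∈ {−1, 0, 1}` by energy conservation in the pair, Tonelli);
* (ii) the KINETIC ENERGY bound `E_{λ_N} ∑ᵢ‖vᵢ(s)‖² ≤ (N+1) m₂` and (iii) the GAUSSIAN TAILS
  `n_0(E) ≤ K₀(N+1)e^{−α₀E}`, `n_s(E) ≤ K₀^{N+2}e^{−α₀E}` — `censusLedger_statics`
  (`…LevelCensusStatics`: Fernique + disintegration of the local Gibbs law, conservation of energy);
* (iv) `λ_N`-a.e. MEASURABILITY of the velocity-event counts `eventSum (Φ N) s s' S` for Borel `S` —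
  `aemeasurable_eventSum` (`…LevelCensusEventMeasurable`: continuous mark functionals by the dyadic
  velocity-jump engine, closed events by thickened indicators, Borel events by the π-λ theorem for
  the event measures; `ae_mem_good_localGibbsLaw`).

References: Cercignani–Illner–Pulvirenti 1994 §4 (collision records of the flow); Spohn 1991
Part I §2.3 (local Gibbs states); Gamba–Panferov–Villani 2009 (comparison principles).
-/

noncomputable section

open MeasureTheory Set Filter
open scoped ENNReal

namespace Summit.AtomisticToContinuum.HydrodynamicLimit.Theorems.EnergyCurrentTailsLevelCensus

open Literature.MathematicalPhysics.KineticTheory Literature.Analysis.FluidPDE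

/-- **Stub A — THE CENSUS LEDGER AND THE A-PRIORI INPUTS (no chaos).**  For continuous positive
profiles, `σ₀ = 1/2` works: for `0 < σ < 1/2` and every flow family `Φ N`, (i) the exact crossing
ledger of the expected level census (`censusLedger_identity`), (ii) the kinetic-energy bound and
(iii) the Gaussian census tails of the local Gibbs data propagated by energy conservation
(`censusLedger_statics`), and (iv) the `λ_N`-a.e. measurability of the velocity-event counts for
Borel events (`aemeasurable_eventSum`, `ae_mem_good_localGibbsLaw`).  Registered stub of the line
`level-census-comparison` (crux stmt-AtomisticToContinuum-9235, `EnergyCurrentTails`). [folklore] -/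
theorem stub_censusLedger : CensusLedger := by
  intro a₀ θ₀ u₀ ha hθ hu ha0 hθ0
  refine ⟨1 / 2, by norm_num, fun σ hσ hσ2 Φ => ⟨?_, ?_, ?_, ?_⟩⟩
  · exact fun N s s' E _ hss' => censusLedger_identity a₀ θ₀ u₀ σ hσ hσ2 N (Φ N) s s' E hss'
  · exact (censusLedger_statics a₀ θ₀ u₀ ha hθ hu ha0 hθ0 σ hσ hσ2 Φ).1
  · exact (censusLedger_statics a₀ θ₀ u₀ ha hθ hu ha0 hθ0 σ hσ hσ2 Φ).2
  · exact fun N s s' S hS =>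
      aemeasurable_eventSum hσ hσ2 (Φ N) s s' hS (ae_mem_good_localGibbsLaw σ a₀ u₀ θ₀ N (Φ N))

end Summit.AtomisticToContinuum.HydrodynamicLimit.Theorems.EnergyCurrentTailsLevelCensus
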